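import Summits.ResolutionOfSingularities.ResolutionOfSingularities.Theorems.FrobeniusClosingPatchingRelPerfectCoreRungTowerInitialForm
import HarnessLib

/-!
# Crux `PatchingRelPerfect` (stmt-ResolutionOfSingularities-16161), chain w52 — CORE RUNG r1τ,
# part 6: POWERS and DIAGONAL REDUCTIONS (`(z)ᵃ + 𝔪ᵃᵇ`, exponents `{a, ab}`, cone-form powers)

[OURS · L1 W5.2 · rung r1τ] Pure ideal algebra on top of the towers (parts 1–5) and stub-2's
closure of the companion class `𝒞` under powers and reductions (`companion_pow`,
`companion_of_reduction`, `…CoreRungClosure.lean`):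

* `CoreRungTower.pow_sup_le` — `(P + Q)ⁿ ⊆ T` as soon as every `Pⁱ Qⁿ⁻ⁱ ⊆ T` (binomial theorem in
  the semiring of ideals); `CoreRungTower.diagonal_mul_sup_pow` — the DIAGONAL `Pᵃ + Qᵃ` is a
  reduction of `(P + Q)ᵃ`: `(Pᵃ + Qᵃ) · (P + Q)ᵃ = (P + Q)²ᵃ`; `CoreRungTower.sup_reduction_sup` —
  a sum of reductions is a reduction of the sum; `CoreRungTower.reduction_trans` — reductions
  compose;
* `companion_pow_span_castAdd_sup_pow_maximalIdeal` — `(z)ᵃ + 𝔪ᵃᵇ ∈ 𝒞` (`a ≥ 1`; a reduction of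
  `((z) + 𝔪ᵇ)ᵃ`, whose companion is the `a`-th power of the tower companion of part 2);
* `companion_monomialCI_two_pow`, `coreRung_monomialCI_two_pow` (+ binder shape) — the monomial
  complete intersections `(z₁ᵃ, …, z_mᵃ, y₁ᵃᵇ, …, y_eᵃᵇ)`, i.e. in dimension `4` every
  `(x₁^{a₁}, …, x₄^{a₄})` whose exponents take TWO values one dividing the other
  (`{a, ab}`: `(x², y², z⁴, w⁴)`, `(x³, y³, z³, w⁶)`, …), extending `{1, d}` (part 2) and `{1, 2}`
  (r1c + r1d);
* `companion_form_pow_sup_pow`, `coreRung_form_pow_sup_pow` — idea-2's `ConeFormAtom` shape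
  `(qᵃ) + 𝔪^{a(d+e+1)}` for `q = F(x) + r` with regular projective tangent cone (part 5), every
  `a ≥ 1`, `e ≥ 0` (the thickness a multiple of `a`; general thickness needs the Euclidean tower
  on `(uᵅ, vᵝ)`, not done here).

FORMAT evidence for the core (CHAIN §1 (A)).  Nothing here is a statement of the manuscript under
review.

## References

* The Stacks Project, Tags 080A, 080B. [StacksProject]
* I. Swanson, C. Huneke, *Integral Closure of Ideals, Rings, and Modules*, CUP 2006, §1.2, §8.1
  (reductions; sums and powers). [HunekeSwanson2006]
-/

-- `Summit.<Summit>.<Sub>.Theorems` with `Sub = Summit` (single-conjunct summit, D-0017)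
set_option linter.dupNamespace false

noncomputable section

open CategoryTheory CategoryTheory.Limits AlgebraicGeometry Literature.AlgebraicGeometry.Resolution
open Summit.ResolutionOfSingularities.ResolutionOfSingularities.Theorems.CoreRungTower

namespace Summit.ResolutionOfSingularities.ResolutionOfSingularities.Theorems

universe u

/-! ## Reductions: binomial estimate, diagonals, sums, transitivity -/

namespace CoreRungTower

/-- **`(P + Q)ⁿ ⊆ T` as soon as `Pⁱ · Qⁿ⁻ⁱ ⊆ T` for all `i ≤ n`** (binomial theorem in the
commutative semiring of ideals, where `n • I = I`). [folklore] -/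
theorem pow_sup_le {R : Type*} [CommSemiring R] {P Q T : Ideal R} {n : ℕ}
    (h : ∀ i, i ≤ n → P ^ i * Q ^ (n - i) ≤ T) : (P ⊔ Q) ^ n ≤ T := by
  rw [← Ideal.add_eq_sup, add_pow]
  refine Finset.sum_induction _ (fun I : Ideal R => I ≤ T) (fun I J hI hJ => ?_) ?_ ?_
  · rw [Ideal.add_eq_sup]
    exact sup_le hI hJ
  · rw [Ideal.zero_eq_bot]
    exact bot_le
  · intro i hi
    exact Ideal.mul_le_right.trans (h i (Nat.lt_succ_iff.mp (Finset.mem_range.mp hi)))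

/-- **The diagonal is a reduction of the power of a sum**: `(Pᵃ + Qᵃ) · (P + Q)ᵃ = (P + Q)²ᵃ`
(pigeonhole: a product of `2a` factors from `P ∪ Q` contains `a` factors from `P` or `a` from
`Q`), in the format `I · K¹ = K²` of `companion_of_reduction`. [cite: HunekeSwanson2006, §8.1] -/
theorem diagonal_mul_sup_pow {R : Type*} [CommSemiring R] (P Q : Ideal R) (a : ℕ) :
    (P ^ a ⊔ Q ^ a) * ((P ⊔ Q) ^ a) ^ 1 = ((P ⊔ Q) ^ a) ^ (1 + 1) := by
  rw [pow_one, ← pow_mul, show a * (1 + 1) = a + a by ring]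
  apply le_antisymm
  · rw [pow_add]
    exact Ideal.mul_mono_left (sup_le (Ideal.pow_right_mono le_sup_left a)
      (Ideal.pow_right_mono le_sup_right a))
  · refine pow_sup_le fun i hi => ?_
    by_cases hai : a ≤ i
    · -- at least `a` factors from `P`
      have hsplit : P ^ i * Q ^ (a + a - i) = P ^ a * (P ^ (i - a) * Q ^ (a + a - i)) := by
        rw [← mul_assoc, ← pow_add, Nat.add_sub_cancel' hai]
      rw [hsplit]
      refine Ideal.mul_mono le_sup_left ?_
      calc P ^ (i - a) * Q ^ (a + a - i) ≤ (P ⊔ Q) ^ (i - a) * (P ⊔ Q) ^ (a + a - i) :=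
            Ideal.mul_mono (Ideal.pow_right_mono le_sup_left _)
              (Ideal.pow_right_mono le_sup_right _)
        _ = (P ⊔ Q) ^ a := by rw [← pow_add]; congr 1; omega
    · -- at least `a` factors from `Q`
      have hsplit : P ^ i * Q ^ (a + a - i) = Q ^ a * (P ^ i * Q ^ (a - i)) := by
        rw [mul_left_comm, ← pow_add]; congr 2; omega
      rw [hsplit]
      refine Ideal.mul_mono le_sup_right ?_
      calc P ^ i * Q ^ (a - i) ≤ (P ⊔ Q) ^ i * (P ⊔ Q) ^ (a - i) :=
            Ideal.mul_mono (Ideal.pow_right_mono le_sup_left _)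
              (Ideal.pow_right_mono le_sup_right _)
        _ = (P ⊔ Q) ^ a := by rw [← pow_add]; congr 1; omega

/-- **A sum of reductions is a reduction of the sum**: if `A₀ · Aʳ = Aʳ⁺¹` and `B₀ · Bˢ = Bˢ⁺¹`
(`A₀ ⊆ A`, `B₀ ⊆ B`) then `(A₀ + B₀) · (A + B)ʳ⁺ˢ = (A + B)ʳ⁺ˢ⁺¹`. [cite: HunekeSwanson2006, §8.1] -/
theorem sup_reduction_sup {R : Type*} [CommSemiring R] {A₀ A B₀ B : Ideal R} (hA : A₀ ≤ A)
    (hB : B₀ ≤ B) {r s : ℕ} (hrA : A₀ * A ^ r = A ^ (r + 1)) (hsB : B₀ * B ^ s = B ^ (s + 1)) :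
    (A₀ ⊔ B₀) * (A ⊔ B) ^ (r + s) = (A ⊔ B) ^ (r + s + 1) := by
  apply le_antisymm
  · rw [pow_succ']
    exact Ideal.mul_mono_left (sup_le_sup hA hB)
  · refine pow_sup_le fun i hi => ?_
    by_cases hri : r + 1 ≤ i
    · -- `Aⁱ = A₀ · Aⁱ⁻¹`
      have hAi : A ^ i = A₀ * A ^ (i - 1) := by
        conv_lhs => rw [show i = (r + 1) + (i - (r + 1)) by omega, pow_add, ← hrA, mul_assoc,
          ← pow_add, show r + (i - (r + 1)) = i - 1 by omega]
      rw [hAi, mul_assoc]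
      refine Ideal.mul_mono le_sup_left ?_
      calc A ^ (i - 1) * B ^ (r + s + 1 - i) ≤ (A ⊔ B) ^ (i - 1) * (A ⊔ B) ^ (r + s + 1 - i) :=
            Ideal.mul_mono (Ideal.pow_right_mono le_sup_left _)
              (Ideal.pow_right_mono le_sup_right _)
        _ = (A ⊔ B) ^ (r + s) := by rw [← pow_add]; congr 1; omega
    · -- `Bʲ = B₀ · Bʲ⁻¹` for `j = r + s + 1 - i ≥ s + 1`
      have hBj : B ^ (r + s + 1 - i) = B₀ * B ^ (r + s - i) := by
        conv_lhs => rw [show r + s + 1 - i = (s + 1) + (r - i) by omega, pow_add, ← hsB,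
          mul_assoc, ← pow_add, show s + (r - i) = r + s - i by omega]
      rw [hBj, mul_left_comm]
      refine Ideal.mul_mono le_sup_right ?_
      calc A ^ i * B ^ (r + s - i) ≤ (A ⊔ B) ^ i * (A ⊔ B) ^ (r + s - i) :=
            Ideal.mul_mono (Ideal.pow_right_mono le_sup_left _)
              (Ideal.pow_right_mono le_sup_right _)
        _ = (A ⊔ B) ^ (r + s) := by rw [← pow_add]; congr 1; omega

/-- **Reductions compose**: `I · Jʳ = Jʳ⁺¹` and `J · Kˢ = Kˢ⁺¹` give
`I · Kᴺ = Kᴺ⁺¹` with `N = (s+1) r + s`. [cite: HunekeSwanson2006, §1.2] -/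
theorem reduction_trans {R : Type*} [CommSemiring R] {I J K : Ideal R} {r s : ℕ}
    (h1 : I * J ^ r = J ^ (r + 1)) (h2 : J * K ^ s = K ^ (s + 1)) :
    I * K ^ ((s + 1) * r + s) = K ^ ((s + 1) * r + s + 1) := by
  calc I * K ^ ((s + 1) * r + s) = I * ((K ^ (s + 1)) ^ r * K ^ s) := by
          rw [← pow_mul, ← pow_add]
      _ = I * ((J * K ^ s) ^ r * K ^ s) := by rw [h2]
      _ = (I * J ^ r) * K ^ (s * r + s) := by rw [mul_pow, ← pow_mul, pow_add]; ring
      _ = J ^ (r + 1) * K ^ (s * r + s) := by rw [h1]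
      _ = (J * K ^ s) ^ (r + 1) := by rw [mul_pow, ← pow_mul]; ring
      _ = K ^ ((s + 1) * r + s + 1) := by rw [h2, ← pow_mul]; ring

end CoreRungTower

/-! ## `(z)ᵃ + 𝔪ᵃᵇ` and the monomial complete intersections with exponents `{a, ab}` -/

section LocalRung

variable {S : Type u} [CommRing S] [IsRegularLocalRing S] {m e : ℕ} (x : Fin (m + e) → S)
  (hx : Ideal.span (Set.range x) = IsLocalRing.maximalIdeal S)
  (hd : (IsLocalRing.maximalIdeal S).spanFinrank = m + e)

local notation3 "Pz" => Ideal.span (Set.range fun j : Fin m => x (Fin.castAdd e j))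
local notation3 "Yy" => Ideal.span (Set.range fun k : Fin e => x (Fin.natAdd m k))

include hx hd in
/-- **`((z) + 𝔪ᵇ)ᵃ ∈ 𝒞`** (the `a`-th power of the tower ideal; stub-2's `companion_pow`).
[cite: StacksProject, Tag 080A] -/
theorem companion_span_castAdd_sup_pow_maximalIdeal_pow (a b : ℕ) (ha : 0 < a) :
    ∃ (Q : Ideal S) (m' : ℕ), IsLocalRing.maximalIdeal S ^ m' ≤ Q ∧
      ∃ (B : Scheme.{u}) (b' : B ⟶ Spec (.of S)),
        IsBlowup b' (affineBlowup.idealSheaf ((Pz ⊔ IsLocalRing.maximalIdeal S ^ b) ^ a * Q)) ∧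
        Scheme.IsRegular B :=
  companion_pow ha (companion_span_castAdd_sup_pow_maximalIdeal x hx hd b)

include hx hd in
/-- **`(z)ᵃ + 𝔪ᵃᵇ ∈ 𝒞`** (`a ≥ 1`): the diagonal `(z)ᵃ + (𝔪ᵇ)ᵃ` is a reduction of
`((z) + 𝔪ᵇ)ᵃ ∈ 𝒞`. [cite: StacksProject, Tag 080A] [cite: HunekeSwanson2006, §8.1] -/
theorem companion_pow_span_castAdd_sup_pow_maximalIdeal (a b : ℕ) (ha : 0 < a) :
    ∃ (Q : Ideal S) (m' : ℕ), IsLocalRing.maximalIdeal S ^ m' ≤ Q ∧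
      ∃ (B : Scheme.{u}) (b' : B ⟶ Spec (.of S)),
        IsBlowup b' (affineBlowup.idealSheaf
          ((Pz ^ a ⊔ IsLocalRing.maximalIdeal S ^ (b * a)) * Q)) ∧ Scheme.IsRegular B := by
  have hKm : IsLocalRing.maximalIdeal S ^ (b * a) ≤ (Pz ⊔ IsLocalRing.maximalIdeal S ^ b) ^ a := by
    rw [pow_mul]
    exact Ideal.pow_right_mono le_sup_right a
  have hred := diagonal_mul_sup_pow (Pz) (IsLocalRing.maximalIdeal S ^ b) a
  rw [← pow_mul] at hred
  exact companion_of_reduction hKm hred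
    (companion_span_castAdd_sup_pow_maximalIdeal_pow x hx hd a b ha)

include hx hd in
/-- **CORE RUNG r1τ — `(z)ᵃ + 𝔪ᵃᵇ`.** Every blowing up of `Spec S` along `(z₁, …, z_m)ᵃ + 𝔪ᵃᵇ ≠ 0`
(`a ≥ 1`) satisfies the conclusion of the blow-up-form open core `AtomDimFourBlowupAt`.
[cite: StacksProject, Tag 080A] -/
theorem coreRung_pow_span_castAdd_sup_pow_maximalIdeal (a b : ℕ) (ha : 0 < a)
    (hI : Pz ^ a ⊔ IsLocalRing.maximalIdeal S ^ (b * a) ≠ ⊥) (T : Scheme.{u})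
    (f : T ⟶ Spec (.of S))
    (hf : IsBlowup f (affineBlowup.idealSheaf (Pz ^ a ⊔ IsLocalRing.maximalIdeal S ^ (b * a)))) :
    ∃ (J : T.IdealSheafData) (T' : Scheme.{u}) (π : T' ⟶ T), J ≠ ⊥ ∧
      (∀ t : T, t ∈ J.support → f.base t = IsLocalRing.closedPoint S) ∧
      IsBlowup π J ∧ Scheme.IsRegular T' :=
  atomConclusion_of_companion' hI (companion_pow_span_castAdd_sup_pow_maximalIdeal x hx hd a b ha)
    T f hf

include hx hd in
/-- **Monomial complete intersections with exponents in `{a, ab}` are in `𝒞`** (`a, b ≥ 1`):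
`I = (z₁ᵃ, …, z_mᵃ, y₁ᵃᵇ, …, y_eᵃᵇ)` is a reduction of `((z) + (y)ᵇ)ᵃ = ((z) + 𝔪ᵇ)ᵃ` — blockwise
pigeonhole (r1a), sum of reductions, the diagonal, transitivity. [cite: StacksProject, Tag 080A]
[cite: HunekeSwanson2006, §8.1] -/
theorem companion_monomialCI_two_pow (a b : ℕ) (ha : 0 < a) (hb : 0 < b) :
    ∃ (Q : Ideal S) (m' : ℕ), IsLocalRing.maximalIdeal S ^ m' ≤ Q ∧
      ∃ (B : Scheme.{u}) (b' : B ⟶ Spec (.of S)),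
        IsBlowup b' (affineBlowup.idealSheaf
          ((Ideal.span (Set.range fun j : Fin m => x (Fin.castAdd e j) ^ a) ⊔
            Ideal.span (Set.range fun k : Fin e => x (Fin.natAdd m k) ^ (b * a))) * Q)) ∧
        Scheme.IsRegular B := by
  have hzy := CoreRungMonomialCI.span_castAdd_sup_span_natAdd x hx
  -- `T = (z) + (y)ᵇ = (z) + 𝔪ᵇ ∈ 𝒞`, hence `Tᵃ ∈ 𝒞`
  have hT : Pz ⊔ Yy ^ b = Pz ⊔ IsLocalRing.maximalIdeal S ^ b := by
    rw [← hzy]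
    exact sup_pow_eq_sup_sup_pow _ _ b
  have hC := companion_span_castAdd_sup_pow_maximalIdeal_pow x hx hd a b ha
  rw [← hT] at hC
  -- blockwise reductions
  have hza : m * (a - 1) < a + a * m :=
    calc m * (a - 1) ≤ m * a := Nat.mul_le_mul_left m (Nat.sub_le a 1)
      _ = a * m := mul_comm m a
      _ < a + a * m := Nat.lt_add_of_pos_left ha
  have hredZ : Ideal.span (Set.range fun j : Fin m => x (Fin.castAdd e j) ^ a) * (Pz ^ a) ^ m =
      (Pz ^ a) ^ (m + 1) := by
    rw [← pow_mul, ← pow_mul, show a * (m + 1) = a + a * m by ring]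
    exact CoreRung.span_powers_mul_pow_eq_pow _ rfl hza
  have hba : 0 < b * a := Nat.mul_pos hb ha
  have hyb : e * (b * a - 1) < b * a + b * a * e :=
    calc e * (b * a - 1) ≤ e * (b * a) := Nat.mul_le_mul_left e (Nat.sub_le _ 1)
      _ = b * a * e := mul_comm e _
      _ < b * a + b * a * e := Nat.lt_add_of_pos_left hba
  have hredY : Ideal.span (Set.range fun k : Fin e => x (Fin.natAdd m k) ^ (b * a)) *
      ((Yy ^ b) ^ a) ^ e = ((Yy ^ b) ^ a) ^ (e + 1) := by
    have h := CoreRung.span_powers_mul_pow_eq_pow (fun k : Fin e => x (Fin.natAdd m k)) rfl hyb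
    rw [← pow_mul, ← pow_mul, ← pow_mul, ← pow_mul, show b * (a * e) = b * a * e by ring,
      show b * (a * (e + 1)) = b * a + b * a * e by ring]
    exact h
  have hleZ : Ideal.span (Set.range fun j : Fin m => x (Fin.castAdd e j) ^ a) ≤ Pz ^ a := by
    rw [Ideal.span_le]
    rintro _ ⟨j, rfl⟩
    exact Ideal.pow_mem_pow (Ideal.subset_span (Set.mem_range_self j)) a
  have hleY : Ideal.span (Set.range fun k : Fin e => x (Fin.natAdd m k) ^ (b * a)) ≤
      (Yy ^ b) ^ a := by
    rw [← pow_mul, Ideal.span_le]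
    rintro _ ⟨k, rfl⟩
    exact Ideal.pow_mem_pow (Ideal.subset_span (Set.mem_range_self k)) _
  -- `I` is a reduction of the diagonal `D = (z)ᵃ + ((y)ᵇ)ᵃ`, which is a reduction of `Tᵃ`
  have h1 := sup_reduction_sup hleZ hleY hredZ hredY
  have h2 := diagonal_mul_sup_pow (Pz) (Yy ^ b) a
  have h3 := reduction_trans h1 h2
  have hKm : IsLocalRing.maximalIdeal S ^ (b * a) ≤ (Pz ⊔ Yy ^ b) ^ a := by
    rw [hT, pow_mul]
    exact Ideal.pow_right_mono le_sup_right a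
  exact companion_of_reduction hKm h3 hC

include hx in
/-- In positive dimension the ideal `(z₁ᵃ, …, z_mᵃ, y₁ᶜ, …, y_eᶜ)` is non-zero. [folklore] -/
theorem monomialCI_two_pow_ne_bot (a c : ℕ) (h𝔪 : IsLocalRing.maximalIdeal S ≠ ⊥) :
    Ideal.span (Set.range fun j : Fin m => x (Fin.castAdd e j) ^ a) ⊔
      Ideal.span (Set.range fun k : Fin e => x (Fin.natAdd m k) ^ c) ≠ ⊥ := by
  haveI : IsDomain S := isDomain_of_isRegularLocalRing S
  intro h
  apply h𝔪
  rw [← hx, Ideal.span_eq_bot]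
  rintro _ ⟨i, rfl⟩
  induction i using Fin.addCases with
  | left j =>
    have hj : x (Fin.castAdd e j) ^ a ∈ (⊥ : Ideal S) :=
      h ▸ Ideal.mem_sup_left (Ideal.subset_span (Set.mem_range_self j))
    exact (pow_eq_zero_iff' .. |>.mp (by simpa using hj)).1
  | right k =>
    have hk : x (Fin.natAdd m k) ^ c ∈ (⊥ : Ideal S) :=
      h ▸ Ideal.mem_sup_right (Ideal.subset_span (Set.mem_range_self k))
    exact (pow_eq_zero_iff' .. |>.mp (by simpa using hk)).1

include hx hd in
/-- **CORE RUNG r1τ — monomial complete intersections with exponents in `{a, ab}`.** For a regular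
local `S` with regular system of parameters `x = (z₁, …, z_m, y₁, …, y_e)`, `a, b ≥ 1`, and
`I = (z₁ᵃ, …, z_mᵃ, y₁ᵃᵇ, …, y_eᵃᵇ) ≠ 0`, every blowing up `f : T ⟶ Spec S` along `I` satisfies the
conclusion of the blow-up-form open core `AtomDimFourBlowupAt`.  In dimension `4`:
`(x₁^{a₁}, …, x₄^{a₄})` whenever the exponents take two values one dividing the other.  Every
dimension, every regular local base; FORMAT evidence for the core. [cite: StacksProject, Tag 080A] -/
theorem coreRung_monomialCI_two_pow (a b : ℕ) (ha : 0 < a) (hb : 0 < b)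
    (hI : Ideal.span (Set.range fun j : Fin m => x (Fin.castAdd e j) ^ a) ⊔
      Ideal.span (Set.range fun k : Fin e => x (Fin.natAdd m k) ^ (b * a)) ≠ ⊥)
    (T : Scheme.{u}) (f : T ⟶ Spec (.of S))
    (hf : IsBlowup f (affineBlowup.idealSheaf
      (Ideal.span (Set.range fun j : Fin m => x (Fin.castAdd e j) ^ a) ⊔
        Ideal.span (Set.range fun k : Fin e => x (Fin.natAdd m k) ^ (b * a))))) :
    ∃ (J : T.IdealSheafData) (T' : Scheme.{u}) (π : T' ⟶ T), J ≠ ⊥ ∧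
      (∀ t : T, t ∈ J.support → f.base t = IsLocalRing.closedPoint S) ∧
      IsBlowup π J ∧ Scheme.IsRegular T' :=
  atomConclusion_of_companion' hI (companion_monomialCI_two_pow x hx hd a b ha hb) T f hf

end LocalRung

/-- **The registered core's binder shape, restricted to the monomial complete intersections with
exponents in `{a, ab}`** (hypotheses of `stub_atomDimFourBlowup`; dimension, characteristic,
completeness, residue field and the off-fibre hypothesis unused). [cite: StacksProject, Tag 080A] -/
theorem atomDimFourBlowupAt_monomialCI_two_pow (p : ℕ) (_hp : p.Prime) (S : Type)
    [CommRing S] [IsRegularLocalRing S] [CharP S p]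
    [IsAdicComplete (IsLocalRing.maximalIdeal S) S]
    [PerfectField (IsLocalRing.ResidueField S)] (_hS : ringKrullDim S = (4 : ℕ))
    {m e : ℕ} (x : Fin (m + e) → S)
    (hx : Ideal.span (Set.range x) = IsLocalRing.maximalIdeal S)
    (hd : (IsLocalRing.maximalIdeal S).spanFinrank = m + e) (a b : ℕ) (ha : 0 < a) (hb : 0 < b)
    (hI : Ideal.span (Set.range fun j : Fin m => x (Fin.castAdd e j) ^ a) ⊔
      Ideal.span (Set.range fun k : Fin e => x (Fin.natAdd m k) ^ (b * a)) ≠ ⊥)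
    (T : Scheme.{0}) (f : T ⟶ Spec (.of S))
    (hf : IsBlowup f (affineBlowup.idealSheaf
      (Ideal.span (Set.range fun j : Fin m => x (Fin.castAdd e j) ^ a) ⊔
        Ideal.span (Set.range fun k : Fin e => x (Fin.natAdd m k) ^ (b * a)))))
    (_hoff : ∀ t : T, f.base t ≠ IsLocalRing.closedPoint S →
      IsRegularLocalRing (T.presheaf.stalk t)) :
    ∃ (J : T.IdealSheafData) (T' : Scheme.{0}) (π : T' ⟶ T), J ≠ ⊥ ∧
      (∀ t : T, t ∈ J.support → f.base t = IsLocalRing.closedPoint S) ∧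
      IsBlowup π J ∧ Scheme.IsRegular T' :=
  coreRung_monomialCI_two_pow x hx hd a b ha hb hI T f hf

/-! ## Powers of cone forms: `(qᵃ) + 𝔪^{a(d+e+1)}` -/

section FormPowers

variable {S : Type u} [CommRing S] [IsRegularLocalRing S] {n : ℕ} (x : Fin n → S)
  (hx : Ideal.span (Set.range x) = IsLocalRing.maximalIdeal S)
  (hd : (IsLocalRing.maximalIdeal S).spanFinrank = n)
  {d : ℕ} (F : MvPolynomial (Fin n) S) (hF : F.IsHomogeneous d) (r : S)
  (hr : r ∈ IsLocalRing.maximalIdeal S ^ (d + 1))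
  (hform : ∀ i : Fin n,
    MvPolynomial.aeval (fun j : Fin n => if h : j = i then
        (1 : MvPolynomial {j : Fin n // j ≠ i} (S ⧸ Ideal.span (Set.range x)))
      else MvPolynomial.X ⟨j, h⟩)
      (MvPolynomial.map (Ideal.Quotient.mk (Ideal.span (Set.range x))) F) ≠ 0 ∧
    IsRegularRing (MvPolynomial {j : Fin n // j ≠ i} (S ⧸ Ideal.span (Set.range x)) ⧸
      Ideal.span {MvPolynomial.aeval (fun j : Fin n => if h : j = i then
          (1 : MvPolynomial {j : Fin n // j ≠ i} (S ⧸ Ideal.span (Set.range x)))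
        else MvPolynomial.X ⟨j, h⟩)
        (MvPolynomial.map (Ideal.Quotient.mk (Ideal.span (Set.range x))) F)}))

include hx hd hF hr hform in
/-- **`(qᵃ) + 𝔪^{a(d+e+1)} ∈ 𝒞`** for `q = F(x) + r` with regular projective tangent cone (`F` a
form of degree `d`, `r ∈ 𝔪ᵈ⁺¹`, `F̄_i ≠ 0`, `κ[T_j : j ≠ i]/(F̄_i)` regular), every `a ≥ 1`,
`e ≥ 0`: the diagonal of `((q) + 𝔪^{d+e+1})ᵃ ∈ 𝒞` (part 5 + `companion_pow`) — idea-2's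
`ConeFormAtom` shape for thicknesses divisible by `a`. [cite: StacksProject, Tag 080A]
[cite: HunekeSwanson2006, §8.1] -/
theorem companion_form_pow_sup_pow (a : ℕ) (ha : 0 < a) (e : ℕ) :
    ∃ (P : Ideal S) (m' : ℕ), IsLocalRing.maximalIdeal S ^ m' ≤ P ∧
      ∃ (B : Scheme.{u}) (b : B ⟶ Spec (.of S)),
        IsBlowup b (affineBlowup.idealSheaf
          ((Ideal.span {(MvPolynomial.eval x F + r) ^ a} ⊔
            IsLocalRing.maximalIdeal S ^ ((d + e + 1) * a)) * P)) ∧ Scheme.IsRegular B := by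
  have hC := companion_pow ha (companion_form_sup_pow x hx hd F hF r hr hform e)
  have hKm : IsLocalRing.maximalIdeal S ^ ((d + e + 1) * a) ≤
      (Ideal.span {MvPolynomial.eval x F + r} ⊔ IsLocalRing.maximalIdeal S ^ (d + e + 1)) ^ a := by
    rw [pow_mul]
    exact Ideal.pow_right_mono le_sup_right a
  have hred := diagonal_mul_sup_pow (Ideal.span {MvPolynomial.eval x F + r})
    (IsLocalRing.maximalIdeal S ^ (d + e + 1)) a
  rw [← pow_mul, Ideal.span_singleton_pow] at hred
  exact companion_of_reduction hKm hred hC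

include hx hd hF hr hform in
/-- **CORE RUNG r1τ — powers of cone forms.** With `q = F(x) + r` as above (regular projective
tangent cone), every blowing up of `Spec S` along `(qᵃ) + 𝔪^{a(d+e+1)} ≠ 0` satisfies the
conclusion of the blow-up-form open core `AtomDimFourBlowupAt`, for every `a ≥ 1`, `e ≥ 0`.
[cite: StacksProject, Tag 080A] -/
theorem coreRung_form_pow_sup_pow (a : ℕ) (ha : 0 < a) (e : ℕ)
    (hI : Ideal.span {(MvPolynomial.eval x F + r) ^ a} ⊔
      IsLocalRing.maximalIdeal S ^ ((d + e + 1) * a) ≠ ⊥)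
    (T : Scheme.{u}) (f : T ⟶ Spec (.of S))
    (hf : IsBlowup f (affineBlowup.idealSheaf
      (Ideal.span {(MvPolynomial.eval x F + r) ^ a} ⊔
        IsLocalRing.maximalIdeal S ^ ((d + e + 1) * a)))) :
    ∃ (J : T.IdealSheafData) (T' : Scheme.{u}) (π : T' ⟶ T), J ≠ ⊥ ∧
      (∀ t : T, t ∈ J.support → f.base t = IsLocalRing.closedPoint S) ∧
      IsBlowup π J ∧ Scheme.IsRegular T' :=
  atomConclusion_of_companion' hI (companion_form_pow_sup_pow x hx hd F hF r hr hform a ha e)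
    T f hf

end FormPowers

end Summit.ResolutionOfSingularities.ResolutionOfSingularities.Theorems

end
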